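import Summits.CriticalPhenomena.PercolationContinuityZ3.Theorems.PercNearOneGluingNoHeavyQuantLSCoreMMGIneqA
import Summits.CriticalPhenomena.PercolationContinuityZ3.Theorems.PercNearOneGluingNoHeavyQuantLSCoreLLGIneqA
import Summits.CriticalPhenomena.PercolationContinuityZ3.Theorems.PercNearOneGluingNoHeavyQuantLSCoreLLGIneqB
import Summits.CriticalPhenomena.PercolationContinuityZ3.Theorems.PercNearOneGluingNoHeavyQuantLSCoreLLGIneqC
import Summits.CriticalPhenomena.PercolationContinuityZ3.Theorems.PercNearOneGluingNoHeavyQuantLSCoreLLGIneqD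
import Summits.CriticalPhenomena.PercolationContinuityZ3.Theorems.PercNearOneGluingNoHeavyQuantLSCoreLLGIneqE
import Mathlib.Tactic.Linarith
import Mathlib.Tactic.FieldSimp
import Mathlib.Tactic.Ring
import Summits.CriticalPhenomena.PercolationContinuityZ3.Theorems.PercNearOneGluingNoHeavyQuantLSCoreLLGBreakpointsA1
import Summits.CriticalPhenomena.PercolationContinuityZ3.Theorems.PercNearOneGluingNoHeavyQuantLSCoreLLGBreakpointsA2
import HarnessLib

/-!
# QUANT lane R8, T-DEC, binder (II) `ConvClosedTResidue`: LS-CORE, pattern LLG — the breakpoint inequalities of the two-low greedy after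
# pre-routing both row-`m` lows into the head cell (kG)

builds on p205010 (kernel theorem, internal audit signed; external expert review pending)

Support file (`--supports stmt-CriticalPhenomena-4575`), QUANT lane seat prim-quant-census-1 (gen 22), rung R8 of
`run/shared/lean/prim/quant/LADDER.md`.  Theorems only, standard axioms, no sorries.  Memo `…/prim-quant-census-1/LSCORE-G22.md` §9–§10.

Pattern LLG (`2(m+l′) < T`): both light cells of row `m` are lows; `m+l′` (pair "4", deficit `r+d−2w`, span `1−w`, always light) and then
`m+l` (pair "3") are pre-routed into the head cell `p+h`, rests to the giant; the two row-`p` lows then see the head cell (residual capacity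
`cPres`) and the residual pool.  Where a cell would be too large for a certificate the light pre-routing efficiency is replaced by its
lower bound `1/x − 1` (a light pair never costs more than the giant rate) — a monotone weakening proved inside the lemma.

[this work].  The gluing rows served [cite: KozmaNitzan2024, Conjecture 3 (p. 15)]; product measure [cite: Grimmett1999, §1.3 p. 10].
-/

namespace Summit.CriticalPhenomena.PercolationContinuityZ3.Theorems

namespace Quant

namespace LawDec

namespace LSCoreLLG
/-- **`kG` for pattern LLG** (breakpoint at the giant pool): by cases on whether pair 4 is filled at the residual head price. [this work] -/
theorem kG_LLG (x r t d w e2P e3 cP1 pool1 cPres poolres : ℝ) (hx0 : 0 < x) (hx1 : x < 1) (hr0 : 0 ≤ r) (hrx : r < x) (ht : 0 < t) (hw0 : 0 < w) (hw1 : w < 1)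
    (hd0 : 0 ≤ d) (hdx : d < x * w) (hre : 0 < r - x + t * (2 - x)) (hre1 : 0 < 1 - t - r)
    (hM2 : 2 * w < r + d)
    (h2P_N : 1 ≤ (r + d) → e2P = 0)
    (h2P_H : x ≤ (r + d) → (r + d) < 1 → e2P = (1 / (r + d) - 1))
    (h2P_L : (r + d) < x → e2P = (1 / ((1 - x) * (r + d) + x ^ (2:ℕ)) - 1))
    (h3_H : x * (1 + t - w) ≤ (r + d + 2 * t - 2 * w) → e3 = (((1 + t - w) - (r + d + 2 * t - 2 * w)) / (r + d + 2 * t - 2 * w)))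
    (h3_L : (r + d + 2 * t - 2 * w) < x * (1 + t - w) → e3 = (((1 + t - w) - ((1 - x) * (r + d + 2 * t - 2 * w) + x ^ (2:ℕ) * (1 + t - w))) / ((1 - x) * (r + d + 2 * t - 2 * w) + x ^ (2:ℕ) * (1 + t - w))))
    (hc4_f : ((x ^ (2:ℕ) + (1 - x) * d / w) * (1 - x) * ((1 + x - r) * (r - x + t * (2 - x)) / (t * (2 - x ^ (2:ℕ) - (1 - x) * r) - x * (x - r)))) ≤ ((1 - (x ^ (2:ℕ) + (1 - x) * d / w)) * x) * (((1 - w) - ((1 - x) * (r + d - 2 * w) + x ^ (2:ℕ) * (1 - w))) / ((1 - x) * (r + d - 2 * w) + x ^ (2:ℕ) * (1 - w))) → cP1 = ((1 - (x ^ (2:ℕ) + (1 - x) * d / w)) * x) - ((x ^ (2:ℕ) + (1 - x) * d / w) * (1 - x) * ((1 + x - r) * (r - x + t * (2 - x)) / (t * (2 - x ^ (2:ℕ) - (1 - x) * r) - x * (x - r)))) / (((1 - w) - ((1 - x) * (r + d - 2 * w) + x ^ (2:ℕ) * (1 - w))) / ((1 - x) * (r + d - 2 * w) + x ^ (2:ℕ)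 * (1 - w))) ∧ pool1 = ((x ^ (2:ℕ) + (1 - x) * d / w) * (1 - x)))
    (hc4_s : ((1 - (x ^ (2:ℕ) + (1 - x) * d / w)) * x) * (((1 - w) - ((1 - x) * (r + d - 2 * w) + x ^ (2:ℕ) * (1 - w))) / ((1 - x) * (r + d - 2 * w) + x ^ (2:ℕ) * (1 - w))) < ((x ^ (2:ℕ) + (1 - x) * d / w) * (1 - x) * ((1 + x - r) * (r - x + t * (2 - x)) / (t * (2 - x ^ (2:ℕ) - (1 - x) * r) - x * (x - r)))) → cP1 = 0 ∧ pool1 = (((x ^ (2:ℕ) + (1 - x) * d / w) * (1 - x)) - ((x ^ (2:ℕ) + (1 - x) * d / w) * (1 - x) * ((1 + x - r) * (r - x + t * (2 - x)) / (t * (2 - x ^ (2:ℕ) - (1 - x) * r) - x * (x - r)))) + ((1 - (x ^ (2:ℕ) + (1 - x) * d / w)) * x) * (((1 - w) - ((1 - x) * (r + d - 2 * w) + x ^ (2:ℕ) * (1 - w))) / ((1 - x) * (r + d - 2 * w) + x ^ (2:ℕ) * (1 - w)))))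
    (hc3_f : ((x ^ (2:ℕ) + (1 - x) * d / w) * (1 - x) * ((x - r) * (1 - t - r) / (t * (2 - x ^ (2:ℕ) - (1 - x) * r) - x * (x - r)))) ≤ cP1 * e3 → cPres = cP1 - ((x ^ (2:ℕ) + (1 - x) * d / w) * (1 - x) * ((x - r) * (1 - t - r) / (t * (2 - x ^ (2:ℕ) - (1 - x) * r) - x * (x - r)))) / e3 ∧ poolres = pool1)
    (hc3_s : cP1 * e3 < ((x ^ (2:ℕ) + (1 - x) * d / w) * (1 - x) * ((x - r) * (1 - t - r) / (t * (2 - x ^ (2:ℕ) - (1 - x) * r) - x * (x - r)))) → cPres = 0 ∧ poolres = (pool1 - ((x ^ (2:ℕ) + (1 - x) * d / w) * (1 - x) * ((x - r) * (1 - t - r) / (t * (2 - x ^ (2:ℕ) - (1 - x) * r) - x * (x - r)))) + cP1 * e3))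
    (hpre : cPres * e2P ≤ ((1 - (x ^ (2:ℕ) + (1 - x) * d / w)) * (1 - x) * ((1 + x - r) * (r - x + t * (2 - x)) / (t * (2 - x ^ (2:ℕ) - (1 - x) * r) - x * (x - r))))) :
    ((1 - (x ^ (2:ℕ) + (1 - x) * d / w)) * (1 - x) * ((x - r) * (1 - t - r) / (t * (2 - x ^ (2:ℕ) - (1 - x) * r) - x * (x - r)))) + ((1 - (x ^ (2:ℕ) + (1 - x) * d / w)) * (1 - x) * ((1 + x - r) * (r - x + t * (2 - x)) / (t * (2 - x ^ (2:ℕ) - (1 - x) * r) - x * (x - r)))) ≤ cPres * e2P + poolres := by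
  rcases le_or_gt (((x ^ (2:ℕ) + (1 - x) * d / w) * (1 - x) * ((1 + x - r) * (r - x + t * (2 - x)) / (t * (2 - x ^ (2:ℕ) - (1 - x) * r) - x * (x - r))))) (((1 - (x ^ (2:ℕ) + (1 - x) * d / w)) * x) * (((1 - w) - ((1 - x) * (r + d - 2 * w) + x ^ (2:ℕ) * (1 - w))) / ((1 - x) * (r + d - 2 * w) + x ^ (2:ℕ) * (1 - w)))) with hf4 | hs4
  · exact kG_LLG_f x r t d w e2P e3 cP1 pool1 cPres poolres hx0 hx1 hr0 hrx ht hw0 hw1 hd0 hdx hre hre1 hM2 h2P_N h2P_H h2P_L h3_H h3_L hc4_f hc4_s hc3_f hc3_s hpre hf4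
  · exact kG_LLG_s x r t d w e2P e3 cP1 pool1 cPres poolres hx0 hx1 hr0 hrx ht hw0 hw1 hd0 hdx hre hre1 hM2 h2P_N h2P_H h2P_L h3_H h3_L hc4_f hc4_s hc3_f hc3_s hpre hs4

end LSCoreLLG

end LawDec

end Quant

end Summit.CriticalPhenomena.PercolationContinuityZ3.Theorems
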